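import Summits.QuantumAdvantage.AdviceFreeQNC0.AffBells35Fibres

/-!
# AffBells35 — STAR COUNTING (ask P-38d of planner qa-qnc0-p1 g35, ROUND-34 §2.2): imperfect stars at many roots force imperfect-fibre mass

Cell qa-qnc0, route DWalkThree (crux stmt-QuantumAdvantage-22907; working rung (NP₁)); prover qn-prover-3 g19.

THEOREM `starCounting : StarCounting` — if every root `x ∈ X` (odd inputs) has at least an `η`-fraction of the `k`-subsets `H` of the
window `R` carrying an IMPERFECT STAR (some created input `x_S`, `S ⊆ H`, is odd and lies in an imperfect fibre), then
`η·|X| ≤ 2^k · #imperfectFibres`.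

PROOF (the planner's five-line double count).  Let `T = {(x, H, S) : x ∈ X, H ∈ R.powersetCard k, S ⊆ H, x_S odd and imperfect}`.
(i) For each `x` and each imperfect star `H` choose such an `S`: `(x, H) ↦ (x, H, S)` is injective, so
`#T ≥ Σ_{x ∈ X} #{H : imperfect star} ≥ η · C(|R|, k) · |X|`.  (ii) `(x, H, S) ↦ (x_S, H, S)` is injective (`x_S` flipped again at `S`
is `x`: `Fib19.flipAt_flipAt`) into `imperfectFibres × {(H, S) : H ∈ R.powersetCard k, S ⊆ H}`, a set of size
`#imperfectFibres · C(|R|,k) · 2^k`.  Divide by `C(|R|,k) > 0` (`k ≤ |R|`).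
WHAT THIS IS NOT: no crux closed; separation NOT moved.
-/

namespace Summit.QuantumAdvantage.AdviceFreeQNC0.AffBells35

open Finset Classical Literature.Computability.QuantumComplexity Literature.Computability.QuantumComplexity.RingHLF
open AffBells23 Fib19 AffBells26

variable {N : ℕ}

/-- `x ↦ x_S` is an involution (all creations of `S` applied twice). -/
theorem xS_xS (x : Fin N → Bool) (S : Finset (Fin N)) : xS (xS x S) S = x := by
  unfold xS
  exact flipAt_flipAt x _

/-- the pairs `(H, S)` with `H` a `k`-subset of `R` and `S ⊆ H` number `C(|R|,k)·2^k`. -/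
theorem card_pairs_subset (R : Finset (Fin N)) (k : ℕ) :
    (((R.powersetCard k) ×ˢ R.powerset).filter fun p : Finset (Fin N) × Finset (Fin N) => p.2 ⊆ p.1).card
      = (R.powersetCard k).card * 2 ^ k := by
  rw [card_filter, sum_product]
  have hH : ∀ H ∈ R.powersetCard k,
      (∑ S ∈ R.powerset, if (H, S).2 ⊆ (H, S).1 then 1 else 0) = 2 ^ k := by
    intro H hH
    obtain ⟨hHR, hcard⟩ := mem_powersetCard.mp hH
    rw [← card_filter]
    have e : R.powerset.filter (fun S => (H, S).2 ⊆ (H, S).1) = H.powerset := by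
      ext S
      simp only [mem_filter, mem_powerset]
      exact ⟨fun h => h.2, fun h => ⟨h.trans hHR, h⟩⟩
    rw [e, card_powerset, hcard]
  rw [sum_congr rfl hH, sum_const, smul_eq_mul]

/-- **STAR COUNTING** (P-38d): `η·|X| ≤ 2^k · #imperfectFibres` whenever every root in `X` has an `η`-fraction of imperfect `k`-stars in `R`. -/
theorem starCounting : StarCounting := by
  intro N k β c R X η hk hodd hstar
  set PK := R.powersetCard k with hPK
  have hPKpos : 0 < PK.card := card_pos.mpr (powersetCard_nonempty.mpr hk)
  -- the triples `(x, (H, S))`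
  set T := ((X ×ˢ (PK ×ˢ R.powerset)).filter fun t : (Fin N → Bool) × (Finset (Fin N) × Finset (Fin N)) =>
      t.2.2 ⊆ t.2.1 ∧ IsOdd (xS t.1 t.2.2) ∧ ImperfectAt β c (xS t.1 t.2.2)) with hT
  -- (i) the imperfect stars inject into `T`
  set Stars := ((X ×ˢ PK).filter fun p : (Fin N → Bool) × Finset (Fin N) => ImperfectStar β c p.1 p.2) with hStars
  have hchoose : ∀ p ∈ Stars, ∃ S : Finset (Fin N), S ⊆ p.2 ∧ IsOdd (xS p.1 S) ∧ ImperfectAt β c (xS p.1 S) := by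
    intro p hp
    obtain ⟨S, hS, h1, h2⟩ := (mem_filter.mp hp).2
    exact ⟨S, hS, h1, h2⟩
  choose! pickS hpickS using hchoose
  have h1 : Stars.card ≤ T.card := by
    refine card_le_card_of_injOn (fun p => (p.1, (p.2, pickS p))) ?_ ?_
    · intro p hp
      have hp' := mem_coe.mp hp
      obtain ⟨hx, hH⟩ := mem_product.mp (mem_filter.mp hp').1
      obtain ⟨hS, ho, hi⟩ := hpickS p hp'
      refine mem_coe.mpr (mem_filter.mpr ⟨mem_product.mpr ⟨hx, mem_product.mpr ⟨hH, ?_⟩⟩, hS, ho, hi⟩)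
      exact mem_powerset.mpr (hS.trans (mem_powersetCard.mp hH).1)
    · intro p _ p' _ he
      simp only [Prod.mk.injEq] at he
      exact Prod.ext he.1 he.2.1
  have hStarsN : Stars.card = ∑ x ∈ X, (PK.filter fun H => ImperfectStar β c x H).card := by
    rw [hStars, card_filter, sum_product]
    refine sum_congr rfl fun x _ => ?_
    rw [card_filter]
  have hlow : η * (PK.card : ℝ) * (X.card : ℝ) ≤ (T.card : ℝ) := by
    calc η * (PK.card : ℝ) * (X.card : ℝ) = ∑ x ∈ X, η * (PK.card : ℝ) := by rw [sum_const, nsmul_eq_mul]; ring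
      _ ≤ ∑ x ∈ X, ((PK.filter fun H => ImperfectStar β c x H).card : ℝ) := sum_le_sum fun x hx => hstar x hx
      _ = (Stars.card : ℝ) := by rw [hStarsN]; push_cast; rfl
      _ ≤ (T.card : ℝ) := by exact_mod_cast h1
  -- (ii) `T` injects into `imperfectFibres × {(H, S) : S ⊆ H}`
  set D := ((PK ×ˢ R.powerset).filter fun p : Finset (Fin N) × Finset (Fin N) => p.2 ⊆ p.1) with hD
  have h2 : T.card ≤ (imperfectFibres β c ×ˢ D).card := by
    refine card_le_card_of_injOn (fun t => (xS t.1 t.2.2, t.2)) ?_ ?_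
    · intro t ht
      obtain ⟨htX, hS, ho, hi⟩ := mem_filter.mp (mem_coe.mp ht)
      obtain ⟨_, hHS⟩ := mem_product.mp htX
      exact mem_coe.mpr (mem_product.mpr ⟨mem_filter.mpr ⟨mem_univ _, ho, hi⟩, mem_filter.mpr ⟨hHS, hS⟩⟩)
    · intro t _ t' _ he
      simp only [Prod.mk.injEq] at he
      obtain ⟨hx, hS⟩ := he
      have hSS : t.2.2 = t'.2.2 := by rw [hS]
      have hx' : t.1 = t'.1 := by
        rw [← xS_xS t.1 t.2.2, hx, hSS, xS_xS]
      exact Prod.ext hx' hS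
  have hDcard : D.card = PK.card * 2 ^ k := card_pairs_subset R k
  have hup : (T.card : ℝ) ≤ ((imperfectFibres β c).card : ℝ) * ((PK.card : ℝ) * 2 ^ k) := by
    have h := h2
    rw [card_product, hDcard] at h
    exact_mod_cast h
  -- combine and divide by `C(|R|, k) > 0`
  have hPKR : (0 : ℝ) < PK.card := by exact_mod_cast hPKpos
  have key : (PK.card : ℝ) * (η * X.card) ≤ (PK.card : ℝ) * (2 ^ k * (imperfectFibres β c).card) := by
    calc (PK.card : ℝ) * (η * X.card) = η * (PK.card : ℝ) * (X.card : ℝ) := by ring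
      _ ≤ ((imperfectFibres β c).card : ℝ) * ((PK.card : ℝ) * 2 ^ k) := hlow.trans hup
      _ = (PK.card : ℝ) * (2 ^ k * (imperfectFibres β c).card) := by ring
  exact le_of_mul_le_mul_left key hPKR

end Summit.QuantumAdvantage.AdviceFreeQNC0.AffBells35
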